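import Summits.ResolutionOfSingularities.ResolutionOfSingularities.Theorems.PurelyInseparableDim4Target
import Summits.ResolutionOfSingularities.ResolutionOfSingularities.Theorems.PurelyInseparableDim4Rules
import Literature.AlgebraicGeometry.Resolution.CentreBlowupOrdAlongBasics
import Mathlib.Algebra.MvPolynomial.Variables
import HarnessLib
import HarnessLib.Audit.Tags

/-!
# Purely inseparable fourfolds — centres INSIDE THE VARIABLE SET: `(3,1)`-traps are `(4,1)`-traps
# [OURS · counted 0 · a statement about OUR frame (`PurelyInseparableDim4Rules`), not about resolution]

Census cell «res-dim4-pi» (D-0157 DOOR 2), width seat `res-dim4-p-14`, brick PR-12e.  WORD #20 (b) (desk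
reduction of TRAP-1): «the trap already lives in `(n,e) = (3,1)` … deleting `x₁` — a one-state trap for
the 3-fold».  This DEF-FREE file types the dictionary behind that sentence for the tree's walk
`CentreBlowup.step`: if the residual polynomial `F` does not involve the variables of `S ∖ S'`
(`S' ⊆ S`), then for every chart `j ∈ S'`

* the `S`-degree of every monomial of `F` is its `S'`-degree, so `ordAlong S F = ordAlong S' F`
  (`ordAlong_eq_of_vanish`), the chart transform, the point transform, «equimultiple point» and the
  whole step COINCIDE for the centres `C_S` and `C_{S'}` (`chartTransform_eq_of_vanish`,
  `step_eq_of_vanish`, `isEquimultiplePoint_iff_of_vanish`) — blowing up the smaller centre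
  `C_S ⊂ C_{S'}` and reading the chart of a variable of `S'` is literally the same move;
* hence edges transfer UP (`edge_of_vanish : Edge q S' s s' → Edge q S s s'`) and permissibility
  transfers DOWN to `S ∩ vars F` (`isPermissibleCentre_inter_vars`, `q ≥ 1`, `F ≠ 0`);
* **`isTrap_of_vars`**: a set of `q`-fold states with non-zero `F` in which every permissible centre
  `S ⊆ vars F` is answered inside the set is an `IsTrap` (answers for the other centres come for free);
* **`isTrap_of_vars_subset`** — the CYLINDER form: if every state of `T` has `vars F ⊆ V` and `T` answers
  every permissible `S ⊆ V`, then `IsTrap q T`.  With `V = {x₂,x₃,x₄}`: a trap of the three-variable game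
  on `x₁`-free states is a trap of the `(4,1)` frame — the `(3,1) ⊂ (4,1)` reduction; a certificate of a
  cylinder trap checks `2^{|V|} − 1` centres instead of `15`.

Nothing here proves resolution of singularities in dimension ≥ 4 / characteristic `p`; counted 0;
AI work, weaker than expert review.
bears_on: LADDER-RESOLUTION:D157-DOOR2 (res-dim4-pi · PR-12e). Supports stmt-ResolutionOfSingularities-16155
(helper).
-/

set_option linter.dupNamespace false

noncomputable section

namespace Summit.ResolutionOfSingularities.ResolutionOfSingularities.Theorems.PIDim4

namespace CentreVars

open MvPolynomial
open Literature.AlgebraicGeometry.Resolution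
open Literature.AlgebraicGeometry.Resolution.CentreBlowup

/-! ## 1. Model level: the step does not see absent variables -/

section Model

variable {σ : Type*} [DecidableEq σ] {K : Type*} [Field K] [DecidableEq K]

omit [DecidableEq σ] [DecidableEq K] in
/-- If `d` vanishes on `S ∖ S'` (`S' ⊆ S`), its `S`-degree is its `S'`-degree. [folklore] -/
theorem degIn_eq_of_vanish {S S' : Finset σ} (hS : S' ⊆ S) {d : σ →₀ ℕ}
    (hd : ∀ i ∈ S, i ∉ S' → d i = 0) : degIn S d = degIn S' d := by
  unfold degIn
  exact (Finset.sum_subset hS hd).symm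

omit [DecidableEq σ] [DecidableEq K] in
/-- If no monomial of `F` involves the variables of `S ∖ S'`, then `ordAlong S F = ordAlong S' F`.
[folklore] -/
theorem ordAlong_eq_of_vanish {S S' : Finset σ} (hS : S' ⊆ S) {F : MvPolynomial σ K}
    (hF : ∀ d ∈ F.support, ∀ i ∈ S, i ∉ S' → d i = 0) : ordAlong S F = ordAlong S' F := by
  rw [ordAlong_eq_inf, ordAlong_eq_inf]
  exact Finset.inf_congr rfl fun d hd => by rw [degIn_eq_of_vanish hS (hF d hd)]

omit [DecidableEq K] in
/-- … the chart exponents for `(S, j)` and `(S', j)` agree on the support of `F`. [folklore] -/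
theorem chartExponent_eq_of_vanish (q : ℕ) {S S' : Finset σ} (hS : S' ⊆ S) (j : σ) {d : σ →₀ ℕ}
    (hd : ∀ i ∈ S, i ∉ S' → d i = 0) : chartExponent q S j d = chartExponent q S' j d := by
  unfold chartExponent
  rw [degIn_eq_of_vanish hS hd]

omit [DecidableEq K] in
/-- … the chart transforms for the centres `C_S` and `C_{S'}` coincide. [folklore] -/
theorem chartTransform_eq_of_vanish (q : ℕ) {S S' : Finset σ} (hS : S' ⊆ S) (j : σ)
    {F : MvPolynomial σ K} (hF : ∀ d ∈ F.support, ∀ i ∈ S, i ∉ S' → d i = 0) :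
    chartTransform q S j F = chartTransform q S' j F := by
  unfold chartTransform
  exact Finset.sum_congr rfl fun d hd => by rw [chartExponent_eq_of_vanish q hS j (hF d hd)]

omit [DecidableEq K] in
/-- … the point transforms coincide. [folklore] -/
theorem pointTransform_eq_of_vanish (q : ℕ) {S S' : Finset σ} (hS : S' ⊆ S) (j : σ) (b : σ → K)
    {s : CState σ K} (hF : ∀ d ∈ s.F.support, ∀ i ∈ S, i ∉ S' → d i = 0) :
    pointTransform q S j b s = pointTransform q S' j b s := by
  unfold pointTransform
  rw [chartTransform_eq_of_vanish q hS j hF]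

omit [DecidableEq K] in
/-- … «equimultiple point» is the same condition for both centres. [folklore] -/
theorem isEquimultiplePoint_iff_of_vanish (q : ℕ) {S S' : Finset σ} (hS : S' ⊆ S) (j : σ) (b : σ → K)
    {s : CState σ K} (hF : ∀ d ∈ s.F.support, ∀ i ∈ S, i ∉ S' → d i = 0) :
    IsEquimultiplePoint q S j b s ↔ IsEquimultiplePoint q S' j b s := by
  unfold IsEquimultiplePoint
  rw [pointTransform_eq_of_vanish q hS j b hF]

/-- **The step does not see absent variables**: for `F` not involving the variables of `S ∖ S'`, the
blow-up of `C_S` and of `C_{S'}` read in the chart of `j` at the point `b` give the same new state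
(residual polynomial, multiplicities, exceptional set). [folklore] -/
theorem step_eq_of_vanish (q : ℕ) {S S' : Finset σ} (hS : S' ⊆ S) (j : σ) (b : σ → K)
    {s : CState σ K} (hF : ∀ d ∈ s.F.support, ∀ i ∈ S, i ∉ S' → d i = 0) :
    step q S j b s = step q S' j b s := by
  unfold step newMult
  rw [pointTransform_eq_of_vanish q hS j b hF, ordAlong_eq_of_vanish hS hF]

omit [DecidableEq σ] [DecidableEq K] in
/-- A monomial of `F` vanishes on every variable outside `vars F`. [folklore] -/
theorem apply_eq_zero_of_not_mem_vars {F : MvPolynomial σ K} {d : σ →₀ ℕ} (hd : d ∈ F.support)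
    {i : σ} (hi : i ∉ F.vars) : d i = 0 := by
  by_contra h
  exact hi ((mem_vars_iff_mem_support i).mpr ⟨d, hd, Finsupp.mem_support_iff.mpr h⟩)

end Model

/-! ## 2. Frame level: edges go up, permissibility goes down to `S ∩ vars F` -/

section Frame

variable {K : Type} [Field K] [DecidableEq K] (q : ℕ)

/-- **Edges transfer up**: an edge for the centre `S'` is an edge for every `S ⊇ S'` whose extra
variables do not occur in `F`. [folklore] -/
theorem edge_of_vanish {S S' : Finset (Fin 4)} (hS : S' ⊆ S) {s s' : State K}
    (hF : ∀ d ∈ s.F.support, ∀ i ∈ S, i ∉ S' → d i = 0) (h : Edge q S' s s') : Edge q S s s' := by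
  obtain ⟨j, b, hj, hbj, heq, hne, rfl⟩ := h
  refine ⟨j, b, hS hj, hbj, (isEquimultiplePoint_iff_of_vanish q hS j b hF).mpr heq, ?_, ?_⟩
  · rw [step_eq_of_vanish q hS j b hF]; exact hne
  · rw [step_eq_of_vanish q hS j b hF]

omit [DecidableEq K] in
/-- Permissibility only depends on the variables of `F` inside `S`: for `q ≥ 1` and `F ≠ 0`, a
permissible `S` meets `vars F` and `S ∩ vars F` is permissible. [folklore] -/
theorem isPermissibleCentre_inter_vars (hq : 1 ≤ q) {S : Finset (Fin 4)} {F : MvPolynomial (Fin 4) K}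
    (hF0 : F ≠ 0) (h : IsPermissibleCentre q S F) : IsPermissibleCentre q (S ∩ F.vars) F := by
  obtain ⟨-, hord⟩ := h
  have hvan : ∀ d ∈ F.support, ∀ i ∈ S, i ∉ S ∩ F.vars → d i = 0 := fun d hd i hi hi' =>
    apply_eq_zero_of_not_mem_vars hd fun hv => hi' (Finset.mem_inter.mpr ⟨hi, hv⟩)
  have heq : CentreBlowup.ordAlong S F = CentreBlowup.ordAlong (S ∩ F.vars) F :=
    ordAlong_eq_of_vanish Finset.inter_subset_left hvan
  refine ⟨?_, by rwa [← heq]⟩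
  by_contra hne
  rw [Finset.not_nonempty_iff_eq_empty] at hne
  rw [hne, ordAlong_empty hF0] at heq
  rw [heq] at hord
  have h0 : q ≤ 0 := by exact_mod_cast hord
  omega

/-- **Traps only need answers inside the variable set**: a set of states with non-zero `q`-fold `F`
(`q ≥ 1`) in which every permissible centre `S ⊆ vars F` has an edge staying in the set is a trap.
[folklore] -/
theorem isTrap_of_vars (hq : 1 ≤ q) {T : Set (State K)}
    (h : ∀ s ∈ T, s.F ≠ 0 ∧ (q : ℕ∞) ≤ CentreBlowup.ordAlong Finset.univ s.F ∧
      ∀ S, S ⊆ s.F.vars → IsPermissibleCentre q S s.F → ∃ s' ∈ T, Edge q S s s') :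
    IsTrap q T := by
  intro s hs
  obtain ⟨hF0, hord, hans⟩ := h s hs
  refine ⟨hord, fun S hS => ?_⟩
  obtain ⟨s', hs', hedge⟩ :=
    hans (S ∩ s.F.vars) Finset.inter_subset_right (isPermissibleCentre_inter_vars q hq hF0 hS)
  exact ⟨s', hs', edge_of_vanish q Finset.inter_subset_left
    (fun d hd i hi hi' => apply_eq_zero_of_not_mem_vars hd fun hv => hi' (Finset.mem_inter.mpr ⟨hi, hv⟩))
    hedge⟩

/-- **The cylinder form — `(3,1)`-traps are `(4,1)`-traps**: if every state of `T` has its variables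
inside `V` and `T` answers every permissible centre `S ⊆ V` inside `T`, then `T` is a trap of the
four-variable frame (the centres meeting the absent variables are answered by the same edges).  With
`V = {x₂, x₃, x₄}` this is the desk's `(3,1) ⊂ (4,1)` reduction of WORD #20 (b) for traps. [folklore] -/
theorem isTrap_of_vars_subset (hq : 1 ≤ q) (V : Finset (Fin 4)) {T : Set (State K)}
    (h : ∀ s ∈ T, s.F ≠ 0 ∧ s.F.vars ⊆ V ∧ (q : ℕ∞) ≤ CentreBlowup.ordAlong Finset.univ s.F ∧
      ∀ S, S ⊆ V → IsPermissibleCentre q S s.F → ∃ s' ∈ T, Edge q S s s') :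
    IsTrap q T :=
  isTrap_of_vars q hq fun s hs => by
    obtain ⟨hF0, hV, hord, hans⟩ := h s hs
    exact ⟨hF0, hord, fun S hS hperm => hans S (hS.trans hV) hperm⟩

/-- Corollary: such a cylinder trap, if nonempty, defeats every permissible rule (and, over `𝔽_p`,
every permissible rule over every field of characteristic `p`, `BaseChange.not_terminatesUnder_of_isTrap_zmod`).
[folklore] -/
theorem not_terminatesUnder_of_vars_subset (hq : 1 ≤ q) (V : Finset (Fin 4)) {T : Set (State K)}
    (h : ∀ s ∈ T, s.F ≠ 0 ∧ s.F.vars ⊆ V ∧ (q : ℕ∞) ≤ CentreBlowup.ordAlong Finset.univ s.F ∧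
      ∀ S, S ⊆ V → IsPermissibleCentre q S s.F → ∃ s' ∈ T, Edge q S s s')
    (hne : T.Nonempty) (R : CentreRule K) (hR : IsPermissibleRule q R) : ¬ TerminatesUnder q R :=
  not_terminatesUnder_of_trap q T (isTrap_of_vars_subset q hq V h) hne R hR

end Frame

end CentreVars

end Summit.ResolutionOfSingularities.ResolutionOfSingularities.Theorems.PIDim4

end
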